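import Summits.AnomalousDissipation.AnomalousDissipation.Theorems.FloorCertificate.Negative.WeakDuality
import Literature.Analysis.FluidPDE.CylindricalGenerator
import Literature.Analysis.FluidPDE.EnergySpaceRellich
import Mathlib.MeasureTheory.Measure.Prokhorov
import HarnessLib

/-!
# Tools for stub `stub_minimaxAlternative` of the line `dissipation-deficit-duality`
# (crux stmt-AnomalousDissipation-14091, `TaylorCertificates.FloorCertificate`)

Plumbing on `ProbabilityMeasure H` (`H = Torus.energySpace (Fin 3)`, norm topology, Borel
σ-algebra) for the minimax alternative with slope-bounded multipliers:

* `exists_retraction`, `exists_bcf_eq_on_ball` — a continuous observable of quadratic growth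
  agrees on every ball `{|u|² ≤ ρ}` with a BOUNDED continuous function (radial retraction);
* `integrable_of_ball`, `integral_eq_of_ball`, `continuous_integral_of_ball` — hence it is
  integrable against every finite measure carried by the ball, and its mean is weakly continuous
  on the probability measures carried by the ball
  (`ProbabilityMeasure.continuous_integral_boundedContinuousFunction`);
* `abs_nsGeneratorPairing_grad_growth`, `abs_pairing_growth` — the generator `⟨F(u), Φ'(u)⟩` and
  the work `(u, f)` have quadratic growth (tree: `Torus.exists_abs_nsGeneratorPairing_grad_le`,
  `Torus.abs_pairing_coe_le`);
* `exists_flat_test` — a cylindrical test functional with `⟨F(u), Φ'(u)⟩ = 0` everywhere;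
* `nsGeneratorPairing_of_grad_eq` — linearity of the generator in the test field
  (`Torus.nsGeneratorPairing_sum_smul`);
* `isProbabilityMeasure_mix`, `ae_mix`, `lintegral_mix`, `integral_mix`, `toReal_mix` — convex
  combinations `t μ₁ + (1 − t) μ₂` of probability measures;
* `lagrangian_dirac`, `tail_estimate` — the Lagrangian at a Dirac mass, and the real-arithmetic
  tail bound;
* `lagrangian_lowerSemicontinuous` — lower semicontinuity of the Lagrangian `μ ↦ ε(μ) + ∫⟨F,Φ'⟩dμ + 2θ(∫(u,f)dμ − ε(μ))`
  on a dissipation sublevel set, given the lsc of the mean enstrophy (stub S0).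

References: Ky Fan, *Minimax theorems*, PNAS 39 (1953) 42–47; Foias–Manley–Rosa–Temam,
*Navier–Stokes Equations and Turbulence* (2001), Ch. IV §1.2.
-/

noncomputable section

set_option linter.dupNamespace false

namespace Summit.AnomalousDissipation.AnomalousDissipation.Theorems.TaylorCertificatesFloorCertificate

open MeasureTheory Filter Topology UnitAddTorus
open scoped InnerProductSpace ENNReal NNReal BoundedContinuousFunction
open Literature.Analysis.FunctionSpaces Literature.Analysis.FluidPDE
open Summit.AnomalousDissipation.AnomalousDissipation.Theorems.FloorCertificate.Negative

/-! ## Bounded continuous modifications off a ball -/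

/-- **Radial retraction** of a real normed space onto the closed ball of radius `R > 0`:
`u ↦ (R / max(R, ‖u‖)) • u` is continuous, lands in the ball and fixes it. [folklore] -/
theorem exists_retraction {E : Type*} [NormedAddCommGroup E] [NormedSpace ℝ E] {R : ℝ}
    (hR : 0 < R) :
    ∃ r : E → E, Continuous r ∧ (∀ u, ‖r u‖ ≤ R) ∧ ∀ u, ‖u‖ ≤ R → r u = u := by
  have hm : ∀ u : E, 0 < max R ‖u‖ := fun u => lt_of_lt_of_le hR (le_max_left _ _)
  refine ⟨fun u => (R / max R ‖u‖) • u, ?_, fun u => ?_, fun u hu => ?_⟩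
  · exact (continuous_const.div (continuous_const.max continuous_norm) fun u => (hm u).ne').smul
      continuous_id
  · rw [norm_smul, Real.norm_eq_abs, abs_of_nonneg (div_nonneg hR.le (hm u).le),
      div_mul_eq_mul_div, div_le_iff₀ (hm u)]
    exact mul_le_mul_of_nonneg_left (le_max_right _ _) hR.le
  · simp only
    rw [max_eq_left hu, div_self hR.ne', one_smul]

/-- A continuous observable of quadratic growth on `H` agrees on each ball `{|u|² ≤ ρ}` with a
BOUNDED continuous function (compose with the radial retraction onto a slightly larger ball).
[folklore] -/
theorem exists_bcf_eq_on_ball {h : (Torus.energySpace (Fin 3)) → ℝ} (hc : Continuous h) {K : ℝ}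
    (hK : ∀ u, |h u| ≤ K * (1 + ‖u‖ ^ 2)) (ρ : ℝ) :
    ∃ hb : (Torus.energySpace (Fin 3)) →ᵇ ℝ, ∀ u : (Torus.energySpace (Fin 3)), ‖u‖ ^ 2 ≤ ρ → hb u = h u := by
  have hK0 : 0 ≤ K := by
    have h0 := hK 0
    rw [norm_zero, zero_pow two_ne_zero, add_zero, mul_one] at h0
    exact (abs_nonneg _).trans h0
  set R : ℝ := Real.sqrt (max ρ 0) + 1 with hR
  have hRpos : 0 < R := by positivity
  obtain ⟨r, hr, hrR, hrid⟩ := exists_retraction (E := (Torus.energySpace (Fin 3))) hRpos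
  refine ⟨BoundedContinuousFunction.ofNormedAddCommGroup (h ∘ r) (hc.comp hr) (K * (1 + R ^ 2))
    fun u => ?_, fun u hu => ?_⟩
  · rw [Function.comp_apply, Real.norm_eq_abs]
    refine (hK (r u)).trans (mul_le_mul_of_nonneg_left ?_ hK0)
    have := hrR u
    nlinarith [norm_nonneg (r u)]
  · simp only [BoundedContinuousFunction.coe_ofNormedAddCommGroup, Function.comp_apply]
    rw [hrid u]
    have h1 : ‖u‖ ^ 2 ≤ max ρ 0 := hu.trans (le_max_left _ _)
    exact (le_abs_self _).trans ((Real.abs_le_sqrt h1).trans (le_add_of_nonneg_right zero_le_one))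

/-- A continuous observable of quadratic growth is integrable against every finite measure
carried by a ball. [folklore] -/
theorem integrable_of_ball {h : (Torus.energySpace (Fin 3)) → ℝ} (hc : Continuous h) {K : ℝ}
    (hK : ∀ u, |h u| ≤ K * (1 + ‖u‖ ^ 2)) {ρ : ℝ} (μ : Measure (Torus.energySpace (Fin 3))) [IsFiniteMeasure μ]
    (hμ : ∀ᵐ u ∂μ, ‖u‖ ^ 2 ≤ ρ) : Integrable h μ := by
  obtain ⟨hb, hhb⟩ := exists_bcf_eq_on_ball hc hK ρ
  refine (hb.integrable μ).congr ?_
  filter_upwards [hμ] with u hu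
  exact hhb u hu

/-- Against measures carried by a ball, the mean of a continuous observable of quadratic growth
is the mean of its bounded continuous modification. [folklore] -/
theorem integral_eq_of_ball {h : (Torus.energySpace (Fin 3)) → ℝ} {hb : (Torus.energySpace (Fin 3)) →ᵇ ℝ} {ρ : ℝ}
    (hhb : ∀ u : (Torus.energySpace (Fin 3)), ‖u‖ ^ 2 ≤ ρ → hb u = h u) (μ : Measure (Torus.energySpace (Fin 3)))
    (hμ : ∀ᵐ u ∂μ, ‖u‖ ^ 2 ≤ ρ) : ∫ u, h u ∂μ = ∫ u, hb u ∂μ := by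
  refine integral_congr_ae ?_
  filter_upwards [hμ] with u hu
  exact (hhb u hu).symm

/-- **Weak continuity of means on ball-carried probability measures**: for a continuous
observable `h` of quadratic growth and any set `S` of probability measures carried by the ball
`{|u|² ≤ ρ}`, `μ ↦ ∫ h dμ` is continuous on `S` (topology of weak convergence). [folklore] -/
theorem continuous_integral_of_ball {h : (Torus.energySpace (Fin 3)) → ℝ} (hc : Continuous h) {K : ℝ}
    (hK : ∀ u, |h u| ≤ K * (1 + ‖u‖ ^ 2)) {ρ : ℝ} {S : Set (ProbabilityMeasure (Torus.energySpace (Fin 3)))}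
    (hS : ∀ μ ∈ S, ∀ᵐ u ∂(μ : Measure (Torus.energySpace (Fin 3))), ‖u‖ ^ 2 ≤ ρ) :
    Continuous fun μ : S => ∫ u, h u ∂((μ : ProbabilityMeasure (Torus.energySpace (Fin 3))) : Measure (Torus.energySpace (Fin 3))) := by
  obtain ⟨hb, hhb⟩ := exists_bcf_eq_on_ball hc hK ρ
  have heq : (fun μ : S => ∫ u, h u ∂((μ : ProbabilityMeasure (Torus.energySpace (Fin 3))) : Measure (Torus.energySpace (Fin 3)))) =
      fun μ : S => ∫ u, hb u ∂((μ : ProbabilityMeasure (Torus.energySpace (Fin 3))) : Measure (Torus.energySpace (Fin 3))) :=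
    funext fun μ => integral_eq_of_ball hhb _ (hS μ.1 μ.2)
  rw [heq]
  exact (ProbabilityMeasure.continuous_integral_boundedContinuousFunction hb).comp
    continuous_subtype_val

/-! ## The two observables: generator and work -/

/-- Quadratic growth of the tested generator `u ↦ ⟨F(u), Φ'(u)⟩` (tree:
`Torus.exists_abs_nsGeneratorPairing_grad_le`). [cite: FMRTTurbulence2001, Ch. IV §1.2, p. 197] -/
theorem abs_nsGeneratorPairing_grad_growth (ν : ℝ) {f : (UnitAddTorus (Fin 3) → EuclideanSpace ℝ (Fin 3))} (hf : MemLp f 2 volume)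
    (Φ : Torus.CylindricalTest (Fin 3)) :
    ∃ K : ℝ, ∀ u : (Torus.energySpace (Fin 3)), |Torus.nsGeneratorPairing ν f u (Φ.grad u)| ≤ K * (1 + ‖u‖ ^ 2) := by
  obtain ⟨K, -, hK⟩ := Torus.exists_abs_nsGeneratorPairing_grad_le ν hf Φ
  exact ⟨K, hK⟩

/-- Quadratic growth of the work `u ↦ (u, f)`: `|(u, f)| ≤ ‖f‖ (1 + |u|²)` (Cauchy–Schwarz
`Torus.abs_pairing_coe_le` and `|u| ≤ 1 + |u|²`). [folklore] -/
theorem abs_pairing_growth {f : (UnitAddTorus (Fin 3) → EuclideanSpace ℝ (Fin 3))} (hf : MemLp f 2 volume) (u : (Torus.energySpace (Fin 3))) :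
    |Torus.pairing u.1 f| ≤ ‖hf.toLp f‖ * (1 + ‖u‖ ^ 2) := by
  refine (Torus.abs_pairing_coe_le hf u).trans ?_
  rw [mul_comm]
  refine mul_le_mul_of_nonneg_left ?_ (norm_nonneg _)
  nlinarith [sq_nonneg (‖u‖ - 1), norm_nonneg u]

/-- On the ball `{|u|² ≤ ρ}` the work is bounded: `|(u, f)| ≤ √ρ ‖f‖`. [folklore] -/
theorem abs_pairing_le_of_ball {f : (UnitAddTorus (Fin 3) → EuclideanSpace ℝ (Fin 3))} (hf : MemLp f 2 volume) {ρ : ℝ} {u : (Torus.energySpace (Fin 3))}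
    (hu : ‖u‖ ^ 2 ≤ ρ) : |Torus.pairing u.1 f| ≤ Real.sqrt ρ * ‖hf.toLp f‖ := by
  refine (Torus.abs_pairing_coe_le hf u).trans (mul_le_mul_of_nonneg_right ?_ (norm_nonneg _))
  exact (le_abs_self _).trans (Real.abs_le_sqrt hu)

/-- **The flat test functional**: a cylindrical test functional with no coordinates (`m = 0`,
`φ = 0`) has `Φ'(u) = 0`, hence `⟨F(u), Φ'(u)⟩ = 0` at every state (empty sum in
`Torus.nsGeneratorPairing_grad`). [folklore] -/
theorem exists_flat_test :
    ∃ Φz : Torus.CylindricalTest (Fin 3), ∀ (ν : ℝ) (f : (UnitAddTorus (Fin 3) → EuclideanSpace ℝ (Fin 3))), Integrable f volume →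
      ∀ u : (Torus.energySpace (Fin 3)), Torus.nsGeneratorPairing ν f u (Φz.grad u) = 0 := by
  refine ⟨⟨0, Fin.elim0, fun i => i.elim0, fun i => i.elim0, fun i => i.elim0, fun _ => 0,
    contDiff_zero_fun, HasCompactSupport.zero⟩, fun ν f hf u => ?_⟩
  rw [Torus.nsGeneratorPairing_grad ν hf]
  simp

/-- **Linearity of the generator in the test field, cylindrical form**: if
`Φ₀'(u) = a Φ₁'(u) + b Φ₂'(u)` then `⟨F(u), Φ₀'(u)⟩ = a ⟨F(u), Φ₁'(u)⟩ + b ⟨F(u), Φ₂'(u)⟩`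
(`Torus.nsGeneratorPairing_sum_smul` with two summands). [cite: FMRTTurbulence2001, Ch. IV §1.2, p. 197] -/
theorem nsGeneratorPairing_of_grad_eq (ν : ℝ) {f : (UnitAddTorus (Fin 3) → EuclideanSpace ℝ (Fin 3))} (hf : Integrable f volume) (u : (Torus.energySpace (Fin 3)))
    (a b : ℝ) {Φ₀ Φ₁ Φ₂ : Torus.CylindricalTest (Fin 3)}
    (h : Φ₀.grad u = a • Φ₁.grad u + b • Φ₂.grad u) :
    Torus.nsGeneratorPairing ν f u (Φ₀.grad u) =
      a * Torus.nsGeneratorPairing ν f u (Φ₁.grad u) +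
        b * Torus.nsGeneratorPairing ν f u (Φ₂.grad u) := by
  have hg : ∀ i ∈ (Finset.univ : Finset (Fin 2)), Torus.IsSmooth (![Φ₁.grad u, Φ₂.grad u] i) := by
    intro i _
    fin_cases i
    · exact Torus.CylindricalTest.isSmooth_grad_holds Φ₁ u
    · exact Torus.CylindricalTest.isSmooth_grad_holds Φ₂ u
  have hs := Torus.nsGeneratorPairing_sum_smul ν hf u Finset.univ ![a, b] hg
  have hfun : (fun x => ∑ i ∈ (Finset.univ : Finset (Fin 2)),
      (![a, b] i) • (![Φ₁.grad u, Φ₂.grad u] i) x) = Φ₀.grad u := by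
    funext x
    rw [h, Fin.sum_univ_two]
    simp
  rw [← hfun, hs, Fin.sum_univ_two]
  simp

/-! ## Convex combinations of probability measures -/

/-- `t μ₁ + (1 − t) μ₂` is a probability measure for `t ∈ [0, 1]`. [folklore] -/
theorem isProbabilityMeasure_mix {α : Type*} [MeasurableSpace α] (μ₁ μ₂ : Measure α)
    [IsProbabilityMeasure μ₁] [IsProbabilityMeasure μ₂] {t : ℝ} (ht0 : 0 ≤ t) (ht1 : t ≤ 1) :
    IsProbabilityMeasure (ENNReal.ofReal t • μ₁ + ENNReal.ofReal (1 - t) • μ₂) := by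
  refine ⟨?_⟩
  simp only [Measure.coe_add, Measure.coe_smul, Pi.add_apply, Pi.smul_apply, measure_univ,
    smul_eq_mul, mul_one]
  rw [← ENNReal.ofReal_add ht0 (by linarith), add_sub_cancel, ENNReal.ofReal_one]

/-- Almost-sure properties pass to mixtures. [folklore] -/
theorem ae_mix {α : Type*} [MeasurableSpace α] {μ₁ μ₂ : Measure α} (a b : ℝ≥0∞) {p : α → Prop}
    (h₁ : ∀ᵐ u ∂μ₁, p u) (h₂ : ∀ᵐ u ∂μ₂, p u) : ∀ᵐ u ∂(a • μ₁ + b • μ₂), p u :=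
  ae_add_measure_iff.2 ⟨Measure.ae_smul_measure h₁ _, Measure.ae_smul_measure h₂ _⟩

/-- Lower Lebesgue integrals against mixtures. [folklore] -/
theorem lintegral_mix {α : Type*} [MeasurableSpace α] (μ₁ μ₂ : Measure α) (a b : ℝ≥0∞)
    (G : α → ℝ≥0∞) :
    ∫⁻ u, G u ∂(a • μ₁ + b • μ₂) = a * ∫⁻ u, G u ∂μ₁ + b * ∫⁻ u, G u ∂μ₂ := by
  rw [lintegral_add_measure, lintegral_smul_measure, lintegral_smul_measure, smul_eq_mul,
    smul_eq_mul]

/-- Bochner integrals of integrable observables against `t μ₁ + (1 − t) μ₂`. [folklore] -/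
theorem integral_mix {α : Type*} [MeasurableSpace α] (μ₁ μ₂ : Measure α) {t : ℝ} (ht0 : 0 ≤ t)
    (ht1 : t ≤ 1) {h : α → ℝ} (h₁ : Integrable h μ₁) (h₂ : Integrable h μ₂) :
    ∫ u, h u ∂(ENNReal.ofReal t • μ₁ + ENNReal.ofReal (1 - t) • μ₂) =
      t * ∫ u, h u ∂μ₁ + (1 - t) * ∫ u, h u ∂μ₂ := by
  rw [integral_add_measure (h₁.smul_measure ENNReal.ofReal_ne_top)
      (h₂.smul_measure ENNReal.ofReal_ne_top),
    integral_smul_measure, integral_smul_measure, ENNReal.toReal_ofReal ht0,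
    ENNReal.toReal_ofReal (by linarith), smul_eq_mul, smul_eq_mul]

/-- `toReal` of a mixture of finite values. [folklore] -/
theorem toReal_mix {t : ℝ} (ht0 : 0 ≤ t) (ht1 : t ≤ 1) {E₁ E₂ : ℝ≥0∞} (h₁ : E₁ ≠ ⊤)
    (h₂ : E₂ ≠ ⊤) :
    (ENNReal.ofReal t * E₁ + ENNReal.ofReal (1 - t) * E₂).toReal =
      t * E₁.toReal + (1 - t) * E₂.toReal := by
  rw [ENNReal.toReal_add (ENNReal.mul_ne_top ENNReal.ofReal_ne_top h₁)
      (ENNReal.mul_ne_top ENNReal.ofReal_ne_top h₂),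
    ENNReal.toReal_mul, ENNReal.toReal_mul, ENNReal.toReal_ofReal ht0,
    ENNReal.toReal_ofReal (by linarith)]

/-- A mixture of values `≤ C` is `≤ C`. [folklore] -/
theorem mix_le {t : ℝ} (ht0 : 0 ≤ t) (ht1 : t ≤ 1) {E₁ E₂ C : ℝ≥0∞} (h₁ : E₁ ≤ C)
    (h₂ : E₂ ≤ C) : ENNReal.ofReal t * E₁ + ENNReal.ofReal (1 - t) * E₂ ≤ C := by
  calc ENNReal.ofReal t * E₁ + ENNReal.ofReal (1 - t) * E₂
      ≤ ENNReal.ofReal t * C + ENNReal.ofReal (1 - t) * C := by gcongr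
    _ = C := by
        rw [← add_mul, ← ENNReal.ofReal_add ht0 (by linarith), add_sub_cancel, ENNReal.ofReal_one,
          one_mul]

/-! ## Dirac masses and the tail -/

/-- Singletons of `H` are measurable (Borel σ-algebra of a `T₁` space); recorded as a theorem
because instance search for `MeasurableSingletonClass H` times out at default heartbeats in this
import closure. [folklore] -/
theorem measurableSingletonClass_energySpace : MeasurableSingletonClass (Torus.energySpace (Fin 3)) :=
  OpensMeasurableSpace.toMeasurableSingletonClass

/-- **The Lagrangian at a Dirac mass** is the pointwise Lagrangian:
`ε(δ_u) + ∫⟨F,Φ'⟩dδ_u + 2θ(∫(·,f)dδ_u − ε(δ_u)) = ν‖∇u‖² + ⟨F(u),Φ'(u)⟩ + 2θ((u,f) − ν‖∇u‖²)`.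
[folklore] -/
theorem lagrangian_dirac (ν : ℝ) (f : (UnitAddTorus (Fin 3) → EuclideanSpace ℝ (Fin 3))) (Φ : Torus.CylindricalTest (Fin 3)) (θ : ℝ) (u : (Torus.energySpace (Fin 3))) :
    Torus.ensembleDissipation ν (Measure.dirac u) +
        ∫ v, Torus.nsGeneratorPairing ν f v (Φ.grad v) ∂(Measure.dirac u) +
        2 * θ * ((∫ v : (Torus.energySpace (Fin 3)), Torus.pairing v.1 f ∂(Measure.dirac u)) -
          Torus.ensembleDissipation ν (Measure.dirac u)) =
      ν * (Torus.eGradNormSq (u.1 : UnitAddTorus (Fin 3) → EuclideanSpace ℝ (Fin 3))).toReal +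
        Torus.nsGeneratorPairing ν f u (Φ.grad u) +
        2 * θ * (Torus.pairing u.1 f - ν * (Torus.eGradNormSq (u.1 : UnitAddTorus (Fin 3) → EuclideanSpace ℝ (Fin 3))).toReal) := by
  haveI := measurableSingletonClass_energySpace
  simp only [Torus.ensembleDissipation, Torus.ensembleEnstrophy, lintegral_dirac, integral_dirac]

/-- A property holding at the atom holds almost surely for the Dirac mass. [folklore] -/
theorem ae_dirac_of {p : (Torus.energySpace (Fin 3)) → Prop} {u : (Torus.energySpace (Fin 3))} (hu : p u) : ∀ᵐ v ∂(Measure.dirac u), p v := by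
  haveI := measurableSingletonClass_energySpace
  rw [ae_dirac_eq]
  exact Filter.eventually_pure.2 hu

/-- The mean enstrophy of a Dirac mass is the enstrophy of its atom. [folklore] -/
theorem ensembleEnstrophy_dirac (u : (Torus.energySpace (Fin 3))) :
    Torus.ensembleEnstrophy (Measure.dirac u) = Torus.eGradNormSq (u.1 : UnitAddTorus (Fin 3) → EuclideanSpace ℝ (Fin 3)) := by
  haveI := measurableSingletonClass_energySpace
  simp only [Torus.ensembleEnstrophy, lintegral_dirac]

/-- **The tail estimate** (real arithmetic): with `θ ∈ [−L, 0]`, `|G| ≤ L`, `|W| ≤ B`, `0 ≤ D`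
`η ≥ 0` and `D > c ≥ L(1 + 2B) + |γ| + η + 1`, one has `γ − η ≤ D + G + 2θ(W − D)`.
[folklore] -/
theorem tail_estimate {L θ G W B D c γ η : ℝ} (hL : 0 ≤ L) (hη : 0 ≤ η) (hθL : -L ≤ θ)
    (hθ0 : θ ≤ 0) (hG : |G| ≤ L) (hW : |W| ≤ B) (hD0 : 0 ≤ D) (hcD : c < D)
    (hc : L * (1 + 2 * B) + |γ| + η + 1 ≤ c) : γ - η ≤ D + G + 2 * θ * (W - D) := by
  have h1 : -L ≤ G := (abs_le.1 hG).1
  have h2 : |θ * W| ≤ L * B := by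
    rw [abs_mul]
    exact mul_le_mul (abs_le.2 ⟨by linarith, by linarith⟩) hW (abs_nonneg _) hL
  have h3 : -(L * B) ≤ θ * W := (abs_le.1 h2).1
  have h4 : θ * D ≤ 0 := mul_nonpos_of_nonpos_of_nonneg hθ0 hD0
  have h5 : γ ≤ |γ| := le_abs_self γ
  have h6 : 0 ≤ B := (abs_nonneg W).trans hW
  nlinarith

/-! ## Lower semicontinuity of the Lagrangian in the measure -/

/-- **Lower semicontinuity in the measure.** For a fixed multiplier `(Φ, θ)` with `θ ≤ 0`, the
Lagrangian `μ ↦ ε(μ) + ∫⟨F,Φ'⟩dμ + 2θ(∫(u,f)dμ − ε(μ))` is lower semicontinuous on the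
probability measures carried by the ball `{|u|² ≤ ρ}` with mean enstrophy `≤ C < ∞`:
`(1 − 2θ)ε` is a continuous monotone function (`ENNReal.truncateToReal C`) of the lsc mean
enstrophy, and the generator and work terms are weakly continuous
(`continuous_integral_of_ball`); hypothesis (i) of Ky Fan's minimax theorem (Fan 1953, Thm 2).
[folklore] -/
theorem lagrangian_lowerSemicontinuous :
    ∀ (hS0 : LowerSemicontinuous fun μ : ProbabilityMeasure (Torus.energySpace (Fin 3)) =>
      Torus.ensembleEnstrophy (μ : Measure (Torus.energySpace (Fin 3)))) {ν : ℝ} (hν : 0 < ν)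
      {f : (UnitAddTorus (Fin 3) → EuclideanSpace ℝ (Fin 3))} (hf : MemLp f 2 volume) (ρ : ℝ) {C : ℝ≥0∞} (hC : C ≠ ⊤)
      (Φ : Torus.CylindricalTest (Fin 3)) {θ : ℝ} (hθ : θ ≤ 0),
    LowerSemicontinuous fun x : {μ : ProbabilityMeasure (Torus.energySpace (Fin 3)) |
        (∀ᵐ u ∂(μ : Measure (Torus.energySpace (Fin 3))), ‖u‖ ^ 2 ≤ ρ) ∧ Torus.ensembleEnstrophy (μ : Measure (Torus.energySpace (Fin 3))) ≤ C} =>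
      Torus.ensembleDissipation ν ((x : ProbabilityMeasure (Torus.energySpace (Fin 3))) : Measure (Torus.energySpace (Fin 3))) +
        ∫ u, Torus.nsGeneratorPairing ν f u (Φ.grad u) ∂((x : ProbabilityMeasure (Torus.energySpace (Fin 3))) : Measure (Torus.energySpace (Fin 3))) +
        2 * θ * ((∫ u, Torus.pairing u.1 f ∂((x : ProbabilityMeasure (Torus.energySpace (Fin 3))) : Measure (Torus.energySpace (Fin 3)))) -
          Torus.ensembleDissipation ν ((x : ProbabilityMeasure (Torus.energySpace (Fin 3))) : Measure (Torus.energySpace (Fin 3)))) := by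
  intro hS0 ν hν f hf ρ C hC Φ θ hθ
  set S : Set (ProbabilityMeasure (Torus.energySpace (Fin 3))) := {μ : ProbabilityMeasure (Torus.energySpace (Fin 3)) |
      (∀ᵐ u ∂(μ : Measure (Torus.energySpace (Fin 3))), ‖u‖ ^ 2 ≤ ρ) ∧ Torus.ensembleEnstrophy (μ : Measure (Torus.energySpace (Fin 3))) ≤ C} with hS
  have hmem : ∀ x : S, (∀ᵐ u ∂((x : ProbabilityMeasure (Torus.energySpace (Fin 3))) : Measure (Torus.energySpace (Fin 3))), ‖u‖ ^ 2 ≤ ρ) ∧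
      Torus.ensembleEnstrophy ((x : ProbabilityMeasure (Torus.energySpace (Fin 3))) : Measure (Torus.energySpace (Fin 3))) ≤ C := fun x => by
    have hx := x.2
    simp only [hS, Set.mem_setOf_eq] at hx
    exact hx
  -- the dissipation part: a continuous monotone function of the lsc mean enstrophy
  have h1 : LowerSemicontinuous fun x : S =>
      (1 - 2 * θ) * Torus.ensembleDissipation ν ((x : ProbabilityMeasure (Torus.energySpace (Fin 3))) : Measure (Torus.energySpace (Fin 3))) := by
    have hg : Continuous fun z : ℝ≥0∞ => (1 - 2 * θ) * (ν * ENNReal.truncateToReal C z) :=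
      continuous_const.mul (continuous_const.mul (ENNReal.continuous_truncateToReal hC))
    have hgm : Monotone fun z : ℝ≥0∞ => (1 - 2 * θ) * (ν * ENNReal.truncateToReal C z) :=
      fun a b hab => mul_le_mul_of_nonneg_left
        (mul_le_mul_of_nonneg_left (ENNReal.monotone_truncateToReal hC hab) hν.le) (by linarith)
    have h0 : LowerSemicontinuous fun x : S =>
        Torus.ensembleEnstrophy ((x : ProbabilityMeasure (Torus.energySpace (Fin 3))) : Measure (Torus.energySpace (Fin 3))) :=
      hS0.comp continuous_subtype_val
    have h := hg.comp_lowerSemicontinuous h0 hgm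
    have heq : (fun x : S =>
        (1 - 2 * θ) * Torus.ensembleDissipation ν ((x : ProbabilityMeasure (Torus.energySpace (Fin 3))) : Measure (Torus.energySpace (Fin 3)))) =
        (fun z : ℝ≥0∞ => (1 - 2 * θ) * (ν * ENNReal.truncateToReal C z)) ∘ fun x : S =>
          Torus.ensembleEnstrophy ((x : ProbabilityMeasure (Torus.energySpace (Fin 3))) : Measure (Torus.energySpace (Fin 3))) := by
      funext x
      simp only [Function.comp_apply, Torus.ensembleDissipation]
      rw [ENNReal.truncateToReal_eq_toReal hC (hmem x).2]
    rw [heq]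
    exact h
  -- the generator and work parts are continuous
  obtain ⟨K₁, hK₁⟩ := abs_nsGeneratorPairing_grad_growth ν hf Φ
  have h2 : Continuous fun x : S =>
      ∫ u, Torus.nsGeneratorPairing ν f u (Φ.grad u) ∂((x : ProbabilityMeasure (Torus.energySpace (Fin 3))) : Measure (Torus.energySpace (Fin 3))) :=
    continuous_integral_of_ball
      (Torus.continuous_nsGeneratorPairing_grad ν (hf.integrable one_le_two) Φ) hK₁
      fun μ hμ => (hmem ⟨μ, hμ⟩).1
  have h3 : Continuous fun x : S =>
      ∫ u, Torus.pairing u.1 f ∂((x : ProbabilityMeasure (Torus.energySpace (Fin 3))) : Measure (Torus.energySpace (Fin 3))) :=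
    continuous_integral_of_ball (Torus.continuous_pairing_coe hf) (abs_pairing_growth hf)
      fun μ hμ => (hmem ⟨μ, hμ⟩).1
  have h23 : LowerSemicontinuous fun x : S =>
      ∫ u, Torus.nsGeneratorPairing ν f u (Φ.grad u) ∂((x : ProbabilityMeasure (Torus.energySpace (Fin 3))) : Measure (Torus.energySpace (Fin 3))) +
        2 * θ * ∫ u, Torus.pairing u.1 f ∂((x : ProbabilityMeasure (Torus.energySpace (Fin 3))) : Measure (Torus.energySpace (Fin 3))) :=
    (h2.add (continuous_const.mul h3)).lowerSemicontinuous
  have key : LowerSemicontinuous fun x : S =>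
      (1 - 2 * θ) * Torus.ensembleDissipation ν ((x : ProbabilityMeasure (Torus.energySpace (Fin 3))) : Measure (Torus.energySpace (Fin 3))) +
        (∫ u, Torus.nsGeneratorPairing ν f u (Φ.grad u) ∂((x : ProbabilityMeasure (Torus.energySpace (Fin 3))) : Measure (Torus.energySpace (Fin 3))) +
          2 * θ * ∫ u, Torus.pairing u.1 f ∂((x : ProbabilityMeasure (Torus.energySpace (Fin 3))) : Measure (Torus.energySpace (Fin 3)))) :=
    h1.add h23
  have heq : (fun x : S =>
      Torus.ensembleDissipation ν ((x : ProbabilityMeasure (Torus.energySpace (Fin 3))) : Measure (Torus.energySpace (Fin 3))) +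
        ∫ u, Torus.nsGeneratorPairing ν f u (Φ.grad u) ∂((x : ProbabilityMeasure (Torus.energySpace (Fin 3))) : Measure (Torus.energySpace (Fin 3))) +
        2 * θ * ((∫ u, Torus.pairing u.1 f ∂((x : ProbabilityMeasure (Torus.energySpace (Fin 3))) : Measure (Torus.energySpace (Fin 3)))) -
          Torus.ensembleDissipation ν ((x : ProbabilityMeasure (Torus.energySpace (Fin 3))) : Measure (Torus.energySpace (Fin 3))))) =
      fun x : S =>
        (1 - 2 * θ) * Torus.ensembleDissipation ν ((x : ProbabilityMeasure (Torus.energySpace (Fin 3))) : Measure (Torus.energySpace (Fin 3))) +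
        (∫ u, Torus.nsGeneratorPairing ν f u (Φ.grad u) ∂((x : ProbabilityMeasure (Torus.energySpace (Fin 3))) : Measure (Torus.energySpace (Fin 3))) +
          2 * θ * ∫ u, Torus.pairing u.1 f ∂((x : ProbabilityMeasure (Torus.energySpace (Fin 3))) : Measure (Torus.energySpace (Fin 3)))) := by
    funext x
    ring
  rw [heq]
  exact key

end Summit.AnomalousDissipation.AnomalousDissipation.Theorems.TaylorCertificatesFloorCertificate

end
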